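import Literature.AnabelianGeometry.AbsoluteAnabelian.AutHolomorphicSpacesPSL2RLemmas
import Literature.AnabelianGeometry.AbsoluteAnabelian.AutHolomorphicSpacesRCGroupLemmas
import Mathlib.Analysis.Complex.UpperHalfPlane.FixedPoints
import HarnessLib

/-!
# `Aut^{RC-hol}` of an Aut-holomorphic disc versus `GL(2, ℝ)`: algebra (PROOF-ONLY, [AbsTopIII] Prop. 2.2 (ii))

For a Riemann surface `Y` with a biholomorphic `κ : Y ≃ₜ ℍ`, Mathlib's action of `GL(2, ℝ)` on `ℍ`
(Möbius for positive determinant, anti-Möbius `z ↦ g • z̄` for negative determinant) induces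
`g ↦ κ⁻¹ ∘ (g • ·) ∘ κ : GL(2, ℝ) → (Y ≃ₜ Y)`.  We prove: multiplicativity, kernel = centre
(Mathlib `forall_smul_eq_self_iff_mem_center`), the image consists exactly of the
self-homeomorphisms whose disc picture preserves `cosh ρ` (= the RC-holomorphic ones, by
`AutHolomorphicSpacesRCGroupLemmas`), and an "orientation functional" `δ` on `Y ≃ₜ Y`, continuous,
equal to `1/4` on the biholomorphic elements of the image and `-1/4` on the anti-holomorphic ones
(so both halves are open in the image).

[cite: MochizukiAbsTopIII2015, Proposition 2.2 (ii) p.52]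
-/

noncomputable section

namespace Literature.AnabelianGeometry.AbsoluteAnabelian

open _root_.TopologicalSpace _root_.Topology _root_.Set _root_.Metric _root_.Function _root_.Filter
open scoped _root_.Manifold _root_.ContDiff ComplexConjugate UpperHalfPlane MatrixGroups
open _root_.UpperHalfPlane Literature.Analysis.Complex
open _root_.Complex (discMobius discMobius_self)

section GLPart

variable {Y : Type} [TopologicalSpace Y]

/-- The conjugated action of `GL(2, ℝ)` at a point. [cite: MochizukiAbsTopIII2015, Proposition 2.2 (ii) p.52] -/
theorem conjSmulGL_apply (κ : Y ≃ₜ ℍ) (g : GL (Fin 2) ℝ) (y : Y) :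
    (κ.trans ((Homeomorph.smul g).trans κ.symm)) y = κ.symm (g • κ y) := rfl

/-- Multiplicativity. [cite: MochizukiAbsTopIII2015, Proposition 2.2 (ii) p.52] -/
theorem conjSmulGL_mul (κ : Y ≃ₜ ℍ) (g h : GL (Fin 2) ℝ) :
    κ.trans ((Homeomorph.smul (g * h)).trans κ.symm) =
      κ.trans ((Homeomorph.smul g).trans κ.symm) * κ.trans ((Homeomorph.smul h).trans κ.symm) := by
  ext y
  simp only [Homeomorph.mul_apply, conjSmulGL_apply, Homeomorph.apply_symm_apply, mul_smul]

/-- Unit. [cite: MochizukiAbsTopIII2015, Proposition 2.2 (ii) p.52] -/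
theorem conjSmulGL_one (κ : Y ≃ₜ ℍ) :
    κ.trans ((Homeomorph.smul (1 : GL (Fin 2) ℝ)).trans κ.symm) = 1 := by
  ext y
  simp only [conjSmulGL_apply, one_smul, Homeomorph.symm_apply_apply]
  rfl

/-- Compatibility with `SL(2, ℝ) → GL(2, ℝ)`. [cite: MochizukiAbsTopIII2015, Proposition 2.2 (ii) p.52] -/
theorem conjSmulGL_mapGL (κ : Y ≃ₜ ℍ) (g : SL(2, ℝ)) :
    κ.trans ((Homeomorph.smul (Matrix.SpecialLinearGroup.mapGL ℝ g)).trans κ.symm) =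
      κ.trans ((Homeomorph.smul g).trans κ.symm) := by
  ext y
  rfl

/-- **Kernel = centre.** [cite: MochizukiAbsTopIII2015, Proposition 2.2 (ii) p.52] -/
theorem conjSmulGL_eq_one_iff (κ : Y ≃ₜ ℍ) {g : GL (Fin 2) ℝ} :
    κ.trans ((Homeomorph.smul g).trans κ.symm) = 1 ↔ g ∈ Subgroup.center (GL (Fin 2) ℝ) := by
  rw [← UpperHalfPlane.forall_smul_eq_self_iff_mem_center]
  constructor
  · intro h τ
    have := congrArg (fun ψ : Y ≃ₜ Y => κ (ψ (κ.symm τ))) h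
    simpa [conjSmulGL_apply] using this
  · intro h
    ext y
    simp only [conjSmulGL_apply, h, Homeomorph.symm_apply_apply]
    rfl

/-- In the Cayley disc coordinate, `J = diag(-1, 1)` acts by complex conjugation.
[cite: MochizukiAbsTopIII2015, Proposition 2.2 (ii) p.52] -/
theorem cayley_J_smul {C : unitDiscOpens ≃ₜ ℍ}
    (hCz : ∀ z : ℍ, ((C.symm z : unitDiscOpens) : ℂ) = ((z : ℂ) - Complex.I) / ((z : ℂ) + Complex.I))
    (τ : ℍ) : ((C.symm (UpperHalfPlane.J • τ) : unitDiscOpens) : ℂ) = conj ((C.symm τ : unitDiscOpens) : ℂ) := by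
  rw [hCz, hCz, UpperHalfPlane.coe_J_smul]
  have hw : conj (τ : ℂ) - Complex.I ≠ 0 := by
    intro h
    have h' := congrArg Complex.im h
    simp at h'
    have := τ.im_pos
    linarith
  have hw' : -conj (τ : ℂ) + Complex.I ≠ 0 := by
    intro h; apply hw; linear_combination -h
  rw [map_div₀, map_sub, map_add, Complex.conj_I, sub_neg_eq_add, ← sub_eq_add_neg,
    div_eq_div_iff hw' hw]
  ring

variable [ChartedSpace ℂ Y]

/-- Elements of positive determinant act biholomorphically.
[cite: MochizukiAbsTopIII2015, Proposition 2.2 (ii) p.52] -/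
theorem mdifferentiable_conjSmulGL (κ : Y ≃ₜ ℍ) (hκ : MDifferentiable 𝓘(ℂ, ℂ) 𝓘(ℂ, ℂ) κ)
    (hκs : MDifferentiable 𝓘(ℂ, ℂ) 𝓘(ℂ, ℂ) κ.symm) {g : GL (Fin 2) ℝ} (hg : 0 < g.det.val) :
    MDifferentiable 𝓘(ℂ, ℂ) 𝓘(ℂ, ℂ) (κ.trans ((Homeomorph.smul g).trans κ.symm)) ∧
      MDifferentiable 𝓘(ℂ, ℂ) 𝓘(ℂ, ℂ) (κ.trans ((Homeomorph.smul g).trans κ.symm)).symm := by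
  have hg' : 0 < g⁻¹.det.val := by
    rw [map_inv, Units.val_inv_eq_inv_val]; exact inv_pos.2 hg
  constructor
  · have : (⇑(κ.trans ((Homeomorph.smul g).trans κ.symm))) = ⇑κ.symm ∘ (fun τ : ℍ => g • τ) ∘ ⇑κ := rfl
    rw [this]
    exact hκs.comp ((UpperHalfPlane.mdifferentiable_smul hg).comp hκ)
  · have : (⇑(κ.trans ((Homeomorph.smul g).trans κ.symm)).symm) =
        ⇑κ.symm ∘ (fun τ : ℍ => g⁻¹ • τ) ∘ ⇑κ := by
      funext y; simp only [comp_apply]; rfl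
    rw [this]
    exact hκs.comp ((UpperHalfPlane.mdifferentiable_smul hg').comp hκ)

/-- **The image preserves `cosh ρ`**: the disc picture (with respect to the Cayley coordinate
`e = C⁻¹ ∘ κ`) of every `κ⁻¹ ∘ (g • ·) ∘ κ`, `g ∈ GL(2, ℝ)`, preserves `discCosh`.
[cite: MochizukiAbsTopIII2015, Proposition 2.2 (ii) p.52] -/
theorem discCosh_pic_conjSmulGL (κ : Y ≃ₜ ℍ) (hκ : MDifferentiable 𝓘(ℂ, ℂ) 𝓘(ℂ, ℂ) κ)
    (hκs : MDifferentiable 𝓘(ℂ, ℂ) 𝓘(ℂ, ℂ) κ.symm) {C : unitDiscOpens ≃ₜ ℍ}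
    (hC : MDifferentiable 𝓘(ℂ, ℂ) 𝓘(ℂ, ℂ) C) (hCs : MDifferentiable 𝓘(ℂ, ℂ) 𝓘(ℂ, ℂ) C.symm)
    (hCz : ∀ z : ℍ, ((C.symm z : unitDiscOpens) : ℂ) = ((z : ℂ) - Complex.I) / ((z : ℂ) + Complex.I))
    (g : GL (Fin 2) ℝ) :
    ∀ z ∈ ball (0 : ℂ) 1, ∀ w ∈ ball (0 : ℂ) 1,
      discCosh (Function.extend Subtype.val (Subtype.val ∘ ((κ.trans C.symm).symm.trans
          ((κ.trans ((Homeomorph.smul g).trans κ.symm)).trans (κ.trans C.symm)))) (fun _ => (0 : ℂ)) z)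
        (Function.extend Subtype.val (Subtype.val ∘ ((κ.trans C.symm).symm.trans
          ((κ.trans ((Homeomorph.smul g).trans κ.symm)).trans (κ.trans C.symm)))) (fun _ => (0 : ℂ)) w) =
      discCosh z w := by
  set e : Y ≃ₜ unitDiscOpens := κ.trans C.symm with he_def
  have he : MDifferentiable 𝓘(ℂ, ℂ) 𝓘(ℂ, ℂ) e := hCs.comp hκ
  have hes : MDifferentiable 𝓘(ℂ, ℂ) 𝓘(ℂ, ℂ) e.symm := hκs.comp hC
  -- the picture of `g` in closed form
  have hpic : ∀ (g : GL (Fin 2) ℝ) {z : ℂ} (hz : z ∈ ball (0 : ℂ) 1),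
      Function.extend Subtype.val (Subtype.val ∘ (e.symm.trans
        ((κ.trans ((Homeomorph.smul g).trans κ.symm)).trans e))) (fun _ => (0 : ℂ)) z =
      ((C.symm (g • C ⟨z, hz⟩) : unitDiscOpens) : ℂ) := by
    intro g z hz
    rw [pic_apply_of_mem e _ hz]
    simp only [he_def, Homeomorph.trans_apply, Homeomorph.symm_trans_apply, Homeomorph.symm_symm,
      Homeomorph.apply_symm_apply, Homeomorph.smul_apply]
  intro z hz w hw
  by_cases hg : 0 < g.det.val
  · obtain ⟨hd, hds⟩ := mdifferentiable_conjSmulGL κ hκ hκs hg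
    exact (isDiscAut_pic e he hes hd hds).discCosh_eq (mem_ball_zero_iff.1 hz) (mem_ball_zero_iff.1 hw)
  · -- negative determinant: `g = J * (J * g)` with `det (J g) > 0`
    have hne : g.det.val ≠ 0 := g.det.ne_zero
    have hneg : g.det.val < 0 := lt_of_le_of_ne (not_lt.1 hg) hne
    have hJg : 0 < (UpperHalfPlane.J * g).det.val := by
      rw [map_mul, Units.val_mul, UpperHalfPlane.det_J]
      simp only [Units.val_neg, Units.val_one]
      nlinarith
    obtain ⟨hd, hds⟩ := mdifferentiable_conjSmulGL κ hκ hκs hJg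
    have hautJ := isDiscAut_pic e he hes hd hds
    have hgJ : g = UpperHalfPlane.J * (UpperHalfPlane.J * g) := by
      rw [← mul_assoc, ← sq, UpperHalfPlane.J_sq, one_mul]
    have key : ∀ {u : ℂ} (hu : u ∈ ball (0 : ℂ) 1), ((C.symm (g • C ⟨u, hu⟩) : unitDiscOpens) : ℂ) =
        conj (((C.symm ((UpperHalfPlane.J * g) • C ⟨u, hu⟩)) : unitDiscOpens) : ℂ) := by
      intro u hu
      conv_lhs => rw [hgJ, mul_smul]
      exact cayley_J_smul hCz _
    rw [hpic g hz, hpic g hw, key hz, key hw, discCosh_conj, ← hpic (UpperHalfPlane.J * g) hz,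
      ← hpic (UpperHalfPlane.J * g) hw]
    exact hautJ.discCosh_eq (mem_ball_zero_iff.1 hz) (mem_ball_zero_iff.1 hw)

/-- `conj ∘ (c·φ_a) ∘ conj = c̄·φ_ā`. [cite: MochizukiAbsTopIII2015, Proposition 2.2 (ii) p.52] -/
theorem conj_discRot_conj (c a z : ℂ) : conj (discRot c a (conj z)) = discRot (conj c) (conj a) z := by
  rw [discRot, discRot, map_mul]
  congr 1
  simp only [discMobius, map_div₀, map_sub, map_mul, map_one, Complex.conj_conj]

/-- **Surjectivity onto the isometry pictures**: a self-homeomorphism whose disc picture (Cayley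
coordinate) preserves `discCosh` is `κ⁻¹ ∘ (g • ·) ∘ κ` for some `g ∈ GL(2, ℝ)`.
[cite: MochizukiAbsTopIII2015, Proposition 2.2 (ii) p.52] -/
theorem exists_conjSmulGL_eq (κ : Y ≃ₜ ℍ) (hκ : MDifferentiable 𝓘(ℂ, ℂ) 𝓘(ℂ, ℂ) κ)
    (hκs : MDifferentiable 𝓘(ℂ, ℂ) 𝓘(ℂ, ℂ) κ.symm) {C : unitDiscOpens ≃ₜ ℍ}
    (hC : MDifferentiable 𝓘(ℂ, ℂ) 𝓘(ℂ, ℂ) C) (hCs : MDifferentiable 𝓘(ℂ, ℂ) 𝓘(ℂ, ℂ) C.symm)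
    (hCz : ∀ z : ℍ, ((C.symm z : unitDiscOpens) : ℂ) = ((z : ℂ) - Complex.I) / ((z : ℂ) + Complex.I))
    {ψ : Y ≃ₜ Y}
    (hiso : ∀ z ∈ ball (0 : ℂ) 1, ∀ w ∈ ball (0 : ℂ) 1,
      discCosh (Function.extend Subtype.val (Subtype.val ∘ ((κ.trans C.symm).symm.trans
          (ψ.trans (κ.trans C.symm)))) (fun _ => (0 : ℂ)) z)
        (Function.extend Subtype.val (Subtype.val ∘ ((κ.trans C.symm).symm.trans
          (ψ.trans (κ.trans C.symm)))) (fun _ => (0 : ℂ)) w) = discCosh z w) :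
    ∃ g : GL (Fin 2) ℝ, κ.trans ((Homeomorph.smul g).trans κ.symm) = ψ := by
  set e : Y ≃ₜ unitDiscOpens := κ.trans C.symm with he_def
  have he : MDifferentiable 𝓘(ℂ, ℂ) 𝓘(ℂ, ℂ) e := hCs.comp hκ
  have hes : MDifferentiable 𝓘(ℂ, ℂ) 𝓘(ℂ, ℂ) e.symm := hκs.comp hC
  rcases mdifferentiable_or_conj_of_discCosh_pic e he hes hiso with ⟨hd, hds⟩ | ⟨c, a, hc, ha, hanti⟩
  · obtain ⟨g, hg⟩ := exists_conjSmul_eq κ hκ hκs hd hds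
    exact ⟨Matrix.SpecialLinearGroup.mapGL ℝ g, by rw [conjSmulGL_mapGL, hg]⟩
  · -- compose with `J`: the picture becomes the Möbius map `c̄·φ_ā`
    set ρJ := κ.trans ((Homeomorph.smul UpperHalfPlane.J).trans κ.symm) with hρJ
    have hpicJ : ∀ {z : ℂ} (hz : z ∈ ball (0 : ℂ) 1),
        Function.extend Subtype.val (Subtype.val ∘ (e.symm.trans (ρJ.trans e))) (fun _ => (0 : ℂ)) z =
          conj z := by
      intro z hz
      rw [pic_apply_of_mem e _ hz]
      simp only [he_def, hρJ, Homeomorph.trans_apply, Homeomorph.symm_trans_apply, Homeomorph.symm_symm,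
        Homeomorph.apply_symm_apply, Homeomorph.smul_apply]
      rw [cayley_J_smul hCz, C.symm_apply_apply]
    have hψ' : EqOn (Function.extend Subtype.val (Subtype.val ∘ (e.symm.trans ((ρJ * ψ).trans e)))
        (fun _ => (0 : ℂ))) (discRot (conj c) (conj a)) (ball 0 1) := by
      intro z hz
      rw [pic_mul e ρJ ψ hz, hanti hz, hpicJ ((isDiscAut_discRot hc ha).mapsTo (conj_mem_unitBall hz))]
      exact conj_discRot_conj c a z
    obtain ⟨hd, hds⟩ := mdifferentiable_of_pic_eqOn_discRot e he hes
      (by rwa [Complex.norm_conj]) (by rwa [Complex.norm_conj]) hψ'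
    obtain ⟨g, hg⟩ := exists_conjSmul_eq κ hκ hκs hd hds
    refine ⟨UpperHalfPlane.J⁻¹ * Matrix.SpecialLinearGroup.mapGL ℝ g, ?_⟩
    rw [conjSmulGL_mul, conjSmulGL_mapGL, hg]
    -- `ρJ⁻¹ * (ρJ * ψ) = ψ`, where `ρJ⁻¹ = conjSmulGL J⁻¹`
    have hinv : κ.trans ((Homeomorph.smul UpperHalfPlane.J⁻¹).trans κ.symm) = ρJ⁻¹ := by
      rw [eq_inv_iff_mul_eq_one, hρJ, ← conjSmulGL_mul, inv_mul_cancel, conjSmulGL_one]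
    rw [hinv, inv_mul_cancel_left]

/-! ### The orientation functional -/

omit [ChartedSpace ℂ Y] in
/-- **The orientation functional** `δ(ψ) = Im(φ_{p₀}(p₂) · conj φ_{p₀}(p₁))`, `p_j` the disc picture
of `ψ` at `0, 1/2, i/2`, is continuous on `Y ≃ₜ Y` (compact-open topology).
[cite: MochizukiAbsTopIII2015, Proposition 2.2 (ii) p.52] -/
theorem continuous_orientation (e : Y ≃ₜ unitDiscOpens) :
    letI := homeoCompactOpen Y
    Continuous fun ψ : Y ≃ₜ Y =>
      (discMobius (Function.extend Subtype.val (Subtype.val ∘ (e.symm.trans (ψ.trans e))) (fun _ => (0 : ℂ)) 0)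
          (Function.extend Subtype.val (Subtype.val ∘ (e.symm.trans (ψ.trans e))) (fun _ => (0 : ℂ))
            (Complex.I / 2)) *
        conj (discMobius (Function.extend Subtype.val (Subtype.val ∘ (e.symm.trans (ψ.trans e)))
            (fun _ => (0 : ℂ)) 0)
          (Function.extend Subtype.val (Subtype.val ∘ (e.symm.trans (ψ.trans e))) (fun _ => (0 : ℂ))
            (1 / 2)))).im := by
  letI := homeoCompactOpen Y
  have h0 : (0 : ℂ) ∈ ball (0 : ℂ) 1 := mem_ball_self one_pos
  have h1 : (1 / 2 : ℂ) ∈ ball (0 : ℂ) 1 := by rw [mem_ball_zero_iff]; norm_num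
  have h2 : (Complex.I / 2 : ℂ) ∈ ball (0 : ℂ) 1 := by
    rw [mem_ball_zero_iff, norm_div, Complex.norm_I]; norm_num
  have c0 := continuous_pic_apply e h0
  have c1 := continuous_pic_apply e h1
  have c2 := continuous_pic_apply e h2
  -- denominators `1 - conj p₀ * p_j` do not vanish
  have hden : ∀ (ψ : Y ≃ₜ Y) {u : ℂ} (hu : u ∈ ball (0 : ℂ) 1),
      1 - conj (Function.extend Subtype.val (Subtype.val ∘ (e.symm.trans (ψ.trans e))) (fun _ => (0 : ℂ)) 0)
        * Function.extend Subtype.val (Subtype.val ∘ (e.symm.trans (ψ.trans e))) (fun _ => (0 : ℂ)) u ≠ 0 := by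
    intro ψ u hu
    have ha := mem_ball_zero_iff.1 (mapsTo_extend (e.symm.trans (ψ.trans e)) h0)
    have hb := mem_ball_zero_iff.1 (mapsTo_extend (e.symm.trans (ψ.trans e)) hu)
    intro h
    have : ‖conj (Function.extend Subtype.val (Subtype.val ∘ (e.symm.trans (ψ.trans e))) (fun _ => (0 : ℂ)) 0)
        * Function.extend Subtype.val (Subtype.val ∘ (e.symm.trans (ψ.trans e))) (fun _ => (0 : ℂ)) u‖ = 1 := by
      rw [sub_eq_zero] at h; rw [← h, norm_one]
    rw [norm_mul, Complex.norm_conj] at this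
    nlinarith [norm_nonneg (Function.extend Subtype.val (Subtype.val ∘ (e.symm.trans (ψ.trans e)))
      (fun _ => (0 : ℂ)) 0), norm_nonneg (Function.extend Subtype.val (Subtype.val ∘
      (e.symm.trans (ψ.trans e))) (fun _ => (0 : ℂ)) u)]
  have hm2 : Continuous fun ψ : Y ≃ₜ Y => discMobius
      (Function.extend Subtype.val (Subtype.val ∘ (e.symm.trans (ψ.trans e))) (fun _ => (0 : ℂ)) 0)
      (Function.extend Subtype.val (Subtype.val ∘ (e.symm.trans (ψ.trans e))) (fun _ => (0 : ℂ))
        (Complex.I / 2)) := by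
    unfold discMobius
    exact Continuous.div (c2.sub c0) (continuous_const.sub ((Complex.continuous_conj.comp c0).mul c2))
      fun ψ => hden ψ h2
  have hm1 : Continuous fun ψ : Y ≃ₜ Y => discMobius
      (Function.extend Subtype.val (Subtype.val ∘ (e.symm.trans (ψ.trans e))) (fun _ => (0 : ℂ)) 0)
      (Function.extend Subtype.val (Subtype.val ∘ (e.symm.trans (ψ.trans e))) (fun _ => (0 : ℂ)) (1 / 2)) := by
    unfold discMobius
    exact Continuous.div (c1.sub c0) (continuous_const.sub ((Complex.continuous_conj.comp c0).mul c1))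
      fun ψ => hden ψ h1
  exact Complex.continuous_im.comp (hm2.mul (Complex.continuous_conj.comp hm1))

/-- **Values of the orientation functional** on isometry pictures: `1/4` when the picture is a
Möbius map (then `ψ` is biholomorphic), `-1/4` when it is anti-Möbius (then `ψ` is not
biholomorphic). [cite: MochizukiAbsTopIII2015, Proposition 2.2 (ii) p.52] -/
theorem orientation_dichotomy (e : Y ≃ₜ unitDiscOpens) (he : MDifferentiable 𝓘(ℂ, ℂ) 𝓘(ℂ, ℂ) e)
    (hes : MDifferentiable 𝓘(ℂ, ℂ) 𝓘(ℂ, ℂ) e.symm) {ψ : Y ≃ₜ Y}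
    (hiso : ∀ z ∈ ball (0 : ℂ) 1, ∀ w ∈ ball (0 : ℂ) 1,
      discCosh (Function.extend Subtype.val (Subtype.val ∘ (e.symm.trans (ψ.trans e))) (fun _ => (0 : ℂ)) z)
        (Function.extend Subtype.val (Subtype.val ∘ (e.symm.trans (ψ.trans e))) (fun _ => (0 : ℂ)) w) =
      discCosh z w) :
    ((MDifferentiable 𝓘(ℂ, ℂ) 𝓘(ℂ, ℂ) ψ ∧ MDifferentiable 𝓘(ℂ, ℂ) 𝓘(ℂ, ℂ) ψ.symm) ∧
      (discMobius (Function.extend Subtype.val (Subtype.val ∘ (e.symm.trans (ψ.trans e))) (fun _ => (0 : ℂ)) 0)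
          (Function.extend Subtype.val (Subtype.val ∘ (e.symm.trans (ψ.trans e))) (fun _ => (0 : ℂ))
            (Complex.I / 2)) *
        conj (discMobius (Function.extend Subtype.val (Subtype.val ∘ (e.symm.trans (ψ.trans e)))
            (fun _ => (0 : ℂ)) 0)
          (Function.extend Subtype.val (Subtype.val ∘ (e.symm.trans (ψ.trans e))) (fun _ => (0 : ℂ))
            (1 / 2)))).im = 1 / 4) ∨
    (¬ (MDifferentiable 𝓘(ℂ, ℂ) 𝓘(ℂ, ℂ) ψ ∧ MDifferentiable 𝓘(ℂ, ℂ) 𝓘(ℂ, ℂ) ψ.symm) ∧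
      (discMobius (Function.extend Subtype.val (Subtype.val ∘ (e.symm.trans (ψ.trans e))) (fun _ => (0 : ℂ)) 0)
          (Function.extend Subtype.val (Subtype.val ∘ (e.symm.trans (ψ.trans e))) (fun _ => (0 : ℂ))
            (Complex.I / 2)) *
        conj (discMobius (Function.extend Subtype.val (Subtype.val ∘ (e.symm.trans (ψ.trans e)))
            (fun _ => (0 : ℂ)) 0)
          (Function.extend Subtype.val (Subtype.val ∘ (e.symm.trans (ψ.trans e))) (fun _ => (0 : ℂ))
            (1 / 2)))).im = -(1 / 4)) := by
  set P := Function.extend Subtype.val (Subtype.val ∘ (e.symm.trans (ψ.trans e))) (fun _ => (0 : ℂ))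
    with hP
  have h0 : (0 : ℂ) ∈ ball (0 : ℂ) 1 := mem_ball_self one_pos
  have h1 : (1 / 2 : ℂ) ∈ ball (0 : ℂ) 1 := by rw [mem_ball_zero_iff]; norm_num
  have h2 : (Complex.I / 2 : ℂ) ∈ ball (0 : ℂ) 1 := by
    rw [mem_ball_zero_iff, norm_div, Complex.norm_I]; norm_num
  have hc : ContinuousOn P (ball 0 1) := continuousOn_extend (e.symm.trans (ψ.trans e)).continuous
  obtain ⟨c, a, hca, ha, hP'⟩ := exists_eq_discRot_or_conj_of_discCosh_eq hc (mapsTo_extend _) hiso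
  have hp0n : ‖P 0‖ < 1 := mem_ball_zero_iff.1 (mapsTo_extend _ h0)
  -- `G := φ_{P 0} ∘ (c·φ_a)` is an automorphism fixing `0`, hence a rotation `c'`
  have hG : IsDiscAut (discMobius (P 0) ∘ discRot c a) :=
    (isDiscAut_discMobius hp0n).comp (isDiscAut_discRot hca ha)
  rcases hP' with hP' | hP'
  · -- Möbius picture
    have hG0 : (discMobius (P 0) ∘ discRot c a) 0 = 0 := by
      rw [comp_apply, ← hP' h0, discMobius_self]
    obtain ⟨c', hc', hrot⟩ := hG.exists_eq_mul_of_map_zero hG0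
    refine Or.inl ⟨mdifferentiable_of_pic_eqOn_discRot e he hes hca ha hP', ?_⟩
    have e1 : discMobius (P 0) (P (1 / 2)) = c' * (1 / 2) := by
      have := hrot h1
      simp only [comp_apply] at this
      rw [hP' h1]; exact this
    have e2 : discMobius (P 0) (P (Complex.I / 2)) = c' * (Complex.I / 2) := by
      have := hrot h2
      simp only [comp_apply] at this
      rw [hP' h2]; exact this
    rw [e1, e2]
    have hcc : c' * conj c' = 1 := by
      rw [Complex.mul_conj, ← Complex.sq_norm, hc']; simp
    have hhalf : conj (1 / 2 : ℂ) = 1 / 2 := by rw [map_div₀, map_one, map_ofNat]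
    have : c' * (Complex.I / 2) * conj (c' * (1 / 2)) = Complex.I / 4 * (c' * conj c') := by
      rw [map_mul, hhalf]; ring
    rw [this, hcc, mul_one]
    simp
  · -- anti-Möbius picture
    have hG0 : (discMobius (P 0) ∘ discRot c a) 0 = 0 := by
      rw [comp_apply]
      have : P 0 = discRot c a 0 := by rw [hP' h0]; simp
      rw [← this, discMobius_self]
    obtain ⟨c', hc', hrot⟩ := hG.exists_eq_mul_of_map_zero hG0
    refine Or.inr ⟨fun hd => not_isDiscAut_of_eqOn_discRot_conj hca ha hP'
      (isDiscAut_pic e he hes hd.1 hd.2), ?_⟩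
    have h2' : conj (Complex.I / 2) ∈ ball (0 : ℂ) 1 := conj_mem_unitBall h2
    have hhalf : conj (1 / 2 : ℂ) = 1 / 2 := by rw [map_div₀, map_one, map_ofNat]
    have hI2 : conj (Complex.I / 2) = -(Complex.I / 2) := by rw [map_div₀, Complex.conj_I, map_ofNat, neg_div]
    have e1 : discMobius (P 0) (P (1 / 2)) = c' * (1 / 2) := by
      have := hrot h1
      simp only [comp_apply] at this
      have hP1 := hP' h1
      simp only [hhalf] at hP1
      rw [hP1]; exact this
    have e2 : discMobius (P 0) (P (Complex.I / 2)) = c' * conj (Complex.I / 2) := by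
      have := hrot h2'
      simp only [comp_apply] at this
      have hP2 := hP' h2
      simp only at hP2
      rw [hP2]; exact this
    rw [e1, e2]
    have hcc : c' * conj c' = 1 := by
      rw [Complex.mul_conj, ← Complex.sq_norm, hc']; simp
    have : c' * conj (Complex.I / 2) * conj (c' * (1 / 2)) = -(Complex.I / 4) * (c' * conj c') := by
      rw [map_mul, hhalf, hI2]; ring
    rw [this, hcc, mul_one]
    simp

end GLPart

end Literature.AnabelianGeometry.AbsoluteAnabelian
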